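import Summits.CriticalPhenomena.PercolationContinuityZ3.Theses.PercNearOneGluing
import Literature.Probability.Percolation.PercolationProofs

/-!
# STUB-PLAN sketch — Lean-typed helper statements for `stub_goodStep`
(stub-critic merge of STUB-IDEAS-stub_goodStep-{1,2,3}; crux stmt-CriticalPhenomena-4576 `AdditiveGluing`,
line `subuniform-dead-pocket-maximum`).  Elaboration only (`sorry` bodies).  NOTE: ideator 3's kernel HJ-attach is
REFUTED by an exact rational witness (`HJAttachWitness.md`); it is kept below only as the `Prop` `HjAttachStatement`.  The four abbreviations
`glueW / killSet / pockS / BG` are the explicit lambdas of the landed k24 files (`goodStep24_main`,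
`stub_goodStepOfGlueGood_k24`) and are meant to be INLINED in Theorems files.
-/

namespace Summit.CriticalPhenomena.PercolationContinuityZ3.Cruxes.AdditiveGluing.StubPlanGoodStep

open MeasureTheory Literature.Probability.LatticeModels Literature.Probability.Percolation
open scoped Classical BigOperators

noncomputable section

variable {n : ℕ}

/-- the block `S` glued by weight-1 pairs (k24's lambda `u/S`). -/
def glueW (u : Sym2 (Fin n) → unitInterval) (S : Finset (Fin n)) : Sym2 (Fin n) → unitInterval :=
  fun e => if (∀ x ∈ e, x ∈ S) ∧ ¬ e.IsDiag then 1 else u e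

/-- every pair meeting `W` killed (`u − W`; for `W = {x}` this is k24/k32's `w⁰`). -/
def killSet (u : Sym2 (Fin n) → unitInterval) (W : Finset (Fin n)) : Sym2 (Fin n) → unitInterval :=
  fun e => if ∃ x ∈ W, x ∈ e then 0 else u e

/-- GOOD left side `L_w(sel)` of the registered stub (verbatim shape). -/
def goodL (w : Sym2 (Fin n) → unitInterval) (A : Finset (Fin n)) (o b : Fin n)
    (sel : Finset (Fin n) → Fin n) : ℝ :=
  (prodBernoulli w).real ((⋃ a ∈ A, openConn o a) ∩ (openConn o b)ᶜ)
    + ∑ W ∈ (Finset.univ : Finset (Finset (Fin n))).filter (fun W => o ∈ W ∧ Disjoint W A),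
        (prodBernoulli w).real {ω : BondConfig (Fin n) | openCluster ω o = (W : Set (Fin n))}
          * (prodBernoulli w).real (openConnIn ((W : Set (Fin n))ᶜ) (sel W) b)ᶜ

/-- GOOD of the quadruple `(w, A, o, b)` in the stub's selection form. -/
def Good (w : Sym2 (Fin n) → unitInterval) (A : Finset (Fin n)) (o b : Fin n) : Prop :=
  ∀ (t : ℝ) (sel : Finset (Fin n) → Fin n), (∀ W, sel W ∈ A) →
    (∀ a ∈ A, 1 - t ≤ (prodBernoulli w).real (openConn a b)) → goodL w A o b sel ≤ t

/-- success-form dead-pocket credit of the BLOCK `S` (un-glued weighting `u`):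
`pockS_u(S, sel) = Σ_{W' ∩ A = ∅} μ_u(K_S = W') · μ_u(sel W' ↔ b in W'ᶜ)`, `K_S = ⋃_{s∈S} C(s)`
(the sum in `hker` of `goodStep24_main`, with `μ_{u/S}(K_S = W') = μ_u(K_S = W')`). -/
def pockS (u : Sym2 (Fin n) → unitInterval) (A S : Finset (Fin n)) (b : Fin n)
    (sel : Finset (Fin n) → Fin n) : ℝ :=
  ∑ W' ∈ (Finset.univ : Finset (Finset (Fin n))).filter (fun W' => Disjoint W' A),
    (prodBernoulli u).real {ω : BondConfig (Fin n) | ∀ z : Fin n, (z ∈ W' ↔ ω ∈ ⋃ s ∈ S, openConn s z)}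
      * (prodBernoulli u).real (openConnIn ((W' : Set (Fin n))ᶜ) (sel W') b)

/-- **Block goodness in the UN-GLUED graph** `BG_u(S; a₀, sel)` (= kernel K(S) of ideator 3 =
GLUE-GOOD/`hker` of k24 after un-gluing the two-point function, = CONJ M of k11):
`τ_u(a₀) + μ_u(a₀↮b, a₀↔S, S↔b) ≤ μ_u(S↔b) + pockS_u(S, sel)`. -/
def BG (u : Sym2 (Fin n) → unitInterval) (A S : Finset (Fin n)) (b a₀ : Fin n)
    (sel : Finset (Fin n) → Fin n) : Prop :=
  (prodBernoulli u).real (openConn a₀ b)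
      + (prodBernoulli u).real ((openConn a₀ b)ᶜ ∩ (⋃ s ∈ S, openConn a₀ s) ∩ (⋃ s ∈ S, openConn s b))
    ≤ (prodBernoulli u).real (⋃ s ∈ S, openConn s b) + pockS u A S b sel

/-- **HJ-peel(S, u₁)** ("goodness of the block `S` has room for the hijacks of `u₁`", ideator 3):
`BG-slack_u(S, sel) + μ_u(S↮b, a₀↮S, S↔A, u₁↔b) ≥ μ_u(S↔b, u₁↮b, a₀↔u₁, a₀↮S)`.
For `S = {v}` this is **HJ-attach** (no gluing anywhere: BG-slack of a singleton = GOOD-slack). -/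
def HjPeel (u : Sym2 (Fin n) → unitInterval) (A S : Finset (Fin n)) (b a₀ u₁ : Fin n)
    (sel : Finset (Fin n) → Fin n) : Prop :=
  (prodBernoulli u).real ((⋃ s ∈ S, openConn s b) ∩ (openConn u₁ b)ᶜ ∩ openConn a₀ u₁
      ∩ (⋃ s ∈ S, openConn a₀ s)ᶜ)
    ≤ ((prodBernoulli u).real (⋃ s ∈ S, openConn s b) + pockS u A S b sel
        - (prodBernoulli u).real (openConn a₀ b)
        - (prodBernoulli u).real ((openConn a₀ b)ᶜ ∩ (⋃ s ∈ S, openConn a₀ s) ∩ (⋃ s ∈ S, openConn s b)))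
      + (prodBernoulli u).real ((⋃ s ∈ S, openConn s b)ᶜ ∩ (⋃ s ∈ S, openConn a₀ s)ᶜ
          ∩ (⋃ s ∈ S, ⋃ a ∈ A, openConn s a) ∩ openConn u₁ b)

/-! ## SPINE — the block-growth calculus (Ω + exact peel identity); serves every line.
(Originally ideator 3's route to GLUE-GOOD(S ∪ u₁) from HJ-peel(S, u₁); the HJ-attach kernel itself is REFUTED below,
the calculus stands.) -/

/-- H-peel′ `blockGood_gap_insert` (PROVABLE, size S–M, pure event algebra): the two exact expansions behind the peel
identity — growing the block by `u₁` raises the glued two-point function of `a₀` by `μ(a₀↔S, S↮b, u₁↔b) + Hij` and the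
block's reach of `b` by `μ(S↮b, u₁↔b)`. -/
theorem blockGood_gap_insert (u : Sym2 (Fin n) → unitInterval) (S : Finset (Fin n)) (b a₀ u₁ : Fin n)
    (hb : b ∉ insert u₁ S) (ha₀ : a₀ ∉ insert u₁ S) :
    (prodBernoulli u).real ((openConn a₀ b)ᶜ ∩ (⋃ s ∈ insert u₁ S, openConn a₀ s) ∩ (⋃ s ∈ insert u₁ S, openConn s b))
        = (prodBernoulli u).real ((openConn a₀ b)ᶜ ∩ (⋃ s ∈ S, openConn a₀ s) ∩ (⋃ s ∈ S, openConn s b))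
          + (prodBernoulli u).real ((⋃ s ∈ S, openConn a₀ s) ∩ (⋃ s ∈ S, openConn s b)ᶜ ∩ openConn u₁ b)
          + (prodBernoulli u).real ((⋃ s ∈ S, openConn s b) ∩ (openConn u₁ b)ᶜ ∩ openConn a₀ u₁
              ∩ (⋃ s ∈ S, openConn a₀ s)ᶜ) ∧
    (prodBernoulli u).real (⋃ s ∈ insert u₁ S, openConn s b)
        = (prodBernoulli u).real (⋃ s ∈ S, openConn s b)
          + (prodBernoulli u).real ((⋃ s ∈ S, openConn s b)ᶜ ∩ openConn u₁ b) := by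
  sorry


/-- H-Ω `pocket_exchange` (ideator 3's Lemma Ω; PROVABLE, size M): growing the block by `u₁` loses at
most `μ(K_S dead, u₁ ∉ K_S, u₁ ↔ b)` of dead-pocket credit, up to a change of selection.  The input is
GOOD of `u₁` in `u − W` for every dead `W ⊇ S` not containing `u₁` — induction-hypothesis instances
(fewer positive-degree vertices).  Proof: on `{K_S = W}` the outside is `u − W`-percolation (block
fibre Markov: k28 `stub_offObsFibreMarkov_k28` for a glued source / k24 `goodStep24_block_null`,
`prodBernoulli_real_inter_of_determinedBy_disjoint`), and the `W`-term of the loss is LITERALLY the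
designated form of `GOOD(u − W, A, u₁, b)` (`good_of_exchange`/`goodBridge_identity`, k46); choose
`sel W := argmin_A τ_{u−W}` on dead `W ∌ u₁` and `sel W := sel' W` on `W ∋ u₁`. -/
theorem pocket_exchange (u : Sym2 (Fin n) → unitInterval) (A S : Finset (Fin n)) (b u₁ : Fin n)
    (hbA : b ∈ A) (hSA : Disjoint S A) (hu₁A : u₁ ∉ A) (hu₁S : u₁ ∉ S) (hS : S.Nonempty)
    (hIH : ∀ W : Finset (Fin n), S ⊆ W → Disjoint W A → u₁ ∉ W → Good (killSet u W) A u₁ b)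
    (sel' : Finset (Fin n) → Fin n) (hsel' : ∀ W, sel' W ∈ A) :
    ∃ sel : Finset (Fin n) → Fin n, (∀ W, sel W ∈ A) ∧
      pockS u A S b sel ≤ pockS u A (insert u₁ S) b sel'
        + (prodBernoulli u).real ((⋃ s ∈ S, ⋃ a ∈ A, openConn s a)ᶜ ∩ (⋃ s ∈ S, openConn s u₁)ᶜ
            ∩ openConn u₁ b) := by
  sorry

/-- H-peel `blockGood_insert_of_hjPeel` (ideator 3's L2; PROVABLE, size S–M, pure event algebra +
`measureReal` additivity): the exact peel identity
`BG-slack(S ∪ u₁) = BG-slack(S) + μ(S↮b, u₁↔b, a₀↮S) − μ(S↔b, u₁↮b, a₀↔u₁, a₀↮S) − ΔP`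
(`τ_{S∪u₁}(a₀) − τ_S(a₀) = μ(a₀↔S, S↮b, u₁↔b) + Hij`), combined with Ω's bound on `ΔP` and HJ-peel. -/
theorem blockGood_insert_of_hjPeel (u : Sym2 (Fin n) → unitInterval) (A S : Finset (Fin n))
    (b a₀ u₁ : Fin n) (hbA : b ∈ A) (ha₀A : a₀ ∈ A) (hSA : Disjoint S A) (hu₁A : u₁ ∉ A) (hu₁S : u₁ ∉ S)
    (sel' : Finset (Fin n) → Fin n)
    (hΩ : ∃ sel : Finset (Fin n) → Fin n, (∀ W, sel W ∈ A) ∧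
      pockS u A S b sel ≤ pockS u A (insert u₁ S) b sel'
        + (prodBernoulli u).real ((⋃ s ∈ S, ⋃ a ∈ A, openConn s a)ᶜ ∩ (⋃ s ∈ S, openConn s u₁)ᶜ
            ∩ openConn u₁ b))
    (hHJ : ∀ sel : Finset (Fin n) → Fin n, (∀ W, sel W ∈ A) → HjPeel u A S b a₀ u₁ sel) :
    BG u A (insert u₁ S) b a₀ sel' := by
  sorry

/-- **REFUTED by the critic (exact rational witness, `HJAttachWitness.md` in this crux dir): HJ-attach** = ideator 3's
HJ-peel for a singleton block with the base rule "most attached to `a₀`".  K₆, relays `{2,3,4}`, `b = 5`, `v = 0`, `u₁ = 1`,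
`a₀ = 2` strict minimiser, attach order and badness satisfied, margin `−1.3419·10⁻⁵` (two independent exact enumerations).
With `u₁` isolated the statement is `GOOD(u,A,v,b)`; it fails near the degenerate locus "`u₁` a pendant of `a₀`, `v` hanging on
a non-minimal relay glued to `a₀`", where the 2-block kernel `BG` is tight and Ω's slack carries all of its positivity.
Recorded as a `Prop` (NOT to be registered). -/
def HjAttachStatement : Prop :=
    ∀ (n : ℕ) (u : Sym2 (Fin n) → unitInterval) (A : Finset (Fin n)) (b a₀ v u₁ : Fin n)
      (sel : Finset (Fin n) → Fin n),
      b ∈ A → a₀ ∈ A → v ∉ A → u₁ ∉ A → v ≠ u₁ → (∀ W, sel W ∈ A) →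
      (∀ a ∈ A, (prodBernoulli u).real (openConn a₀ b) ≤ (prodBernoulli u).real (openConn a b)) →
      (prodBernoulli u).real (openConn v b) < (prodBernoulli u).real (openConn a₀ b) →
      (prodBernoulli u).real (openConn u₁ b) < (prodBernoulli u).real (openConn a₀ b) →
      (prodBernoulli u).real (openConn a₀ u₁) ≤ (prodBernoulli u).real (openConn a₀ v) →
      (prodBernoulli u).real (openConn v b ∩ (openConn u₁ b)ᶜ ∩ openConn a₀ u₁)
        ≤ ((prodBernoulli u).real (openConn v b)
            + ∑ W' ∈ (Finset.univ : Finset (Finset (Fin n))).filter (fun W' => Disjoint W' A),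
                (prodBernoulli u).real {ω : BondConfig (Fin n) | openCluster ω v = (W' : Set (Fin n))}
                  * (prodBernoulli u).real (openConnIn ((W' : Set (Fin n))ᶜ) (sel W') b)
            - (prodBernoulli u).real (openConn a₀ b))
          + (prodBernoulli u).real ((openConn v b)ᶜ ∩ (openConn a₀ v)ᶜ ∩ (⋃ a ∈ A, openConn v a)
              ∩ openConn u₁ b)

/-- KERNEL STUB `stub_blockGoodTwo` (register; = `hker` of `goodStep24_main` / CONJ M for a bad block of EXACTLY two vertices,
written un-glued; the first open case — observer with two low neighbours, any number of relays; at `A.card = 3` it is the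
"first non-trivial drift result" asked for in LEAD-STATUS-c1.md).  0 violations in every census so far (k24: 1 600 random +
≈10⁴ climbed; k11 CONJ M; k8 GlueStep; critic: witness-seeded climbs drive it to `0⁺` at the degenerate locus, never below).
Exact anatomy (H-peel + Ω): `slack = GOOD-slack(v) + W − Hij − ΔP`, and NEITHER `GOOD-slack(v) + E − Hij ≥ 0` (HJ-attach, false)
NOR `W − Hij − ΔP ≥ 0` (monotonicity, false in 40 %) may be split off. -/
theorem stub_blockGoodTwo :
    ∀ (n : ℕ) (u : Sym2 (Fin n) → unitInterval) (A : Finset (Fin n)) (b a₀ v u₁ : Fin n)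
      (sel : Finset (Fin n) → Fin n),
      b ∈ A → a₀ ∈ A → v ∉ A → u₁ ∉ A → v ≠ u₁ → (∀ W, sel W ∈ A) →
      (∀ a ∈ A, (prodBernoulli u).real (openConn a₀ b) ≤ (prodBernoulli u).real (openConn a b)) →
      (prodBernoulli u).real (openConn v b) < (prodBernoulli u).real (openConn a₀ b) →
      (prodBernoulli u).real (openConn u₁ b) < (prodBernoulli u).real (openConn a₀ b) →
      (prodBernoulli u).real (openConn a₀ b)
          + (prodBernoulli u).real ((openConn a₀ b)ᶜ ∩ (openConn a₀ v ∪ openConn a₀ u₁) ∩ (openConn v b ∪ openConn u₁ b))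
        ≤ (prodBernoulli u).real (openConn v b ∪ openConn u₁ b)
          + ∑ W' ∈ (Finset.univ : Finset (Finset (Fin n))).filter (fun W' => Disjoint W' A),
              (prodBernoulli u).real
                  {ω : BondConfig (Fin n) | ∀ z : Fin n, (z ∈ W' ↔ ω ∈ openConn v z ∪ openConn u₁ z)}
                * (prodBernoulli u).real (openConnIn ((W' : Set (Fin n))ᶜ) (sel W') b) := by
  sorry

/-- CONJECTURE HJ-∃ (record, do NOT register yet; experiment E1): for a bad 2-block SOME peeling order satisfies HJ-peel.
Unrefuted; witness-seeded climbs drive both orders to `0⁺` simultaneously at the degenerate locus. -/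
def HjExistsTwo : Prop :=
    ∀ (n : ℕ) (u : Sym2 (Fin n) → unitInterval) (A : Finset (Fin n)) (b a₀ v u₁ : Fin n),
      b ∈ A → a₀ ∈ A → v ∉ A → u₁ ∉ A → v ≠ u₁ →
      (∀ a ∈ A, (prodBernoulli u).real (openConn a₀ b) ≤ (prodBernoulli u).real (openConn a b)) →
      (prodBernoulli u).real (openConn v b) < (prodBernoulli u).real (openConn a₀ b) →
      (prodBernoulli u).real (openConn u₁ b) < (prodBernoulli u).real (openConn a₀ b) →
      (∀ sel : Finset (Fin n) → Fin n, (∀ W, sel W ∈ A) → HjPeel u A {v} b a₀ u₁ sel) ∨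
      (∀ sel : Finset (Fin n) → Fin n, (∀ W, sel W ∈ A) → HjPeel u A {u₁} b a₀ v sel)

/-- CONJECTURE `hjPeel_ge_two` (record, do NOT register: its singleton analogue HJ-attach is FALSE, see above; ideator 3's
HJ-peel for blocks `|S| ≥ 2`, least `a₀`-attached vertex last; 0/148 targeted climbs only).  Kept as the statement
experiment E1 must climb at the degenerate locus before anyone relies on it. -/
theorem hjPeel_ge_two_conjecture :
    ∀ (n : ℕ) (u : Sym2 (Fin n) → unitInterval) (A S : Finset (Fin n)) (b a₀ u₁ : Fin n)
      (sel : Finset (Fin n) → Fin n),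
      b ∈ A → a₀ ∈ A → Disjoint S A → 2 ≤ S.card → u₁ ∉ A → u₁ ∉ S → (∀ W, sel W ∈ A) →
      (∀ a ∈ A, (prodBernoulli u).real (openConn a₀ b) ≤ (prodBernoulli u).real (openConn a b)) →
      (∀ x ∈ insert u₁ S, (prodBernoulli u).real (openConn x b) < (prodBernoulli u).real (openConn a₀ b)) →
      (∀ s ∈ S, (prodBernoulli u).real (openConn a₀ u₁) ≤ (prodBernoulli u).real (openConn a₀ s)) →
      HjPeel u A S b a₀ u₁ sel := by
  sorry

/-- H-glue (ideator 2's P1a; PROVABLE, size M, from the landed `stub_gluePushforward` p76780 +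
`stub_glueReach` p76380): un-gluing the two-point function, and glue-invariance of the block terms —
turns `BG (K) A S b a₀ sel` into the literal `hker` inequality of `goodStep24_main`. -/
theorem glue_real_eqs (u : Sym2 (Fin n) → unitInterval) (S W' : Finset (Fin n)) (a₀ b : Fin n)
    (ha₀ : a₀ ∉ S) (hb : b ∉ S) :
    (prodBernoulli (glueW u S)).real (openConn a₀ b) =
        (prodBernoulli u).real (openConn a₀ b)
          + (prodBernoulli u).real ((openConn a₀ b)ᶜ ∩ (⋃ s ∈ S, openConn a₀ s) ∩ (⋃ s ∈ S, openConn s b)) ∧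
    (prodBernoulli (glueW u S)).real (⋃ s ∈ S, openConn s b) = (prodBernoulli u).real (⋃ s ∈ S, openConn s b) ∧
    (prodBernoulli (glueW u S)).real
        {ω : BondConfig (Fin n) | ∀ z : Fin n, (z ∈ W' ↔ ω ∈ ⋃ s ∈ S, openConn s z)} =
      (prodBernoulli u).real
        {ω : BondConfig (Fin n) | ∀ z : Fin n, (z ∈ W' ↔ ω ∈ ⋃ s ∈ S, openConn s z)} := by
  sorry

/-- REDUCTION (glue only, PROVABLE once H-Ω, H-peel, H-glue are in; still valid, but its HJ hypotheses are now known to be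
FALSE in general for singletons — use it only with HJ-∃-type case splits or per certified instance): the `hker` hypothesis of
`goodStep24_main` for ONE bad block `S` (`|S| ≥ 2`) of the star-killed weighting `K`, from HJ-peel-type
hypotheses and the induction hypothesis (which supplies Ω's GOOD instances: `killSet K W` has fewer
positive-degree vertices than `w`, cf. `goodStep24_card_lt`).  Order `S` by DEcreasing
`μ_K(a₀ ↔ ·)`, let `u₁` be the last (least attached) vertex, `S₀ = S.erase u₁`:
`BG K A S b a₀ sel' ⟸ blockGood_insert_of_hjPeel (pocket_exchange …IH…) (stub_hjAttach | stub_hjPeel)`,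
then H-glue.  With exactly two low neighbours only `stub_hjAttach` is consumed. -/
theorem hker_of_hj (K : Sym2 (Fin n) → unitInterval) (A S : Finset (Fin n)) (b a₀ : Fin n)
    (sel' : Finset (Fin n) → Fin n) (hbA : b ∈ A) (hSA : Disjoint S A) (h2 : 2 ≤ S.card)
    (hsel' : ∀ W, sel' W ∈ A) (ha₀A : a₀ ∈ A)
    (hmin : ∀ a ∈ A, (prodBernoulli K).real (openConn a₀ b) ≤ (prodBernoulli K).real (openConn a b))
    (hbad : ∀ v ∈ S, (prodBernoulli K).real (openConn v b) < (prodBernoulli K).real (openConn a₀ b))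
    (hIH : ∀ (W : Finset (Fin n)) (x : Fin n), Disjoint W A → x ∉ A → Good (killSet K W) A x b)
    (hHJ1 : ∀ (v u₁ : Fin n) (sel : Finset (Fin n) → Fin n), v ∈ S → u₁ ∈ S → v ≠ u₁ → (∀ W, sel W ∈ A) →
      (prodBernoulli K).real (openConn a₀ u₁) ≤ (prodBernoulli K).real (openConn a₀ v) →
      HjPeel K A {v} b a₀ u₁ sel)
    (hHJ2 : ∀ (S₀ : Finset (Fin n)) (u₁ : Fin n) (sel : Finset (Fin n) → Fin n), S₀ ⊆ S → 2 ≤ S₀.card →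
      u₁ ∈ S → u₁ ∉ S₀ → (∀ W, sel W ∈ A) →
      (∀ s ∈ S₀, (prodBernoulli K).real (openConn a₀ u₁) ≤ (prodBernoulli K).real (openConn a₀ s)) →
      HjPeel K A S₀ b a₀ u₁ sel) :
    (prodBernoulli (glueW K S)).real (openConn a₀ b) ≤
      (prodBernoulli (glueW K S)).real (⋃ s ∈ S, openConn s b)
        + ∑ W' ∈ (Finset.univ : Finset (Finset (Fin n))).filter (fun W' => Disjoint W' A),
            (prodBernoulli (glueW K S)).real
                {ω : BondConfig (Fin n) | ∀ x : Fin n, (x ∈ W' ↔ ω ∈ ⋃ s ∈ S, openConn s x)}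
              * (prodBernoulli K).real (openConnIn ((W' : Set (Fin n))ᶜ) (sel' W') b) := by
  sorry

/-! ## LINE 2 (rank 2) — certified peeling (ideator 2's P1): an UNCONDITIONAL partial class -/

/-- P1b `blockGood_peel` (PROVABLE, size M–L ≈ the k24 engine file run at a block vertex `x ∈ S`
instead of `o`): exact σ-decomposition of all four terms of BG over the layers `S'` of the open star
of `x`; child block `(S.erase x) ∪ S'` in the star-killed weighting `killSet u {x}`, selection shifted
by `insert x`.  Critic's check: the decomposition is an exact identity termwise (`a₀`-side uses
`S' ⊆ T`), children with `S' ∋ b` or `S' ∩ A ≠ ∅` are Lemma-5 leaves, the child `T = ∅` reads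
`τ_{u−x}(a₀) ≤ τ_{u−x}(sel {x})` (fails exactly when deleting `x` re-orders the relays). -/
theorem blockGood_peel (u : Sym2 (Fin n) → unitInterval) (A S : Finset (Fin n)) (b a₀ x : Fin n)
    (hx : x ∈ S) (hSA : Disjoint S A) (hbA : b ∈ A) (ha₀A : a₀ ∈ A) (sel : Finset (Fin n) → Fin n)
    (hsel : ∀ W, sel W ∈ A)
    (hlayers : ∀ S' : Finset (Fin n), x ∉ S' →
      (prodBernoulli u).real {ω : BondConfig (Fin n) | ∀ y : Fin n, y ≠ x → (s(x, y) ∈ ω ↔ y ∈ S')} ≠ 0 →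
      BG (killSet u {x}) A (S.erase x ∪ S') b a₀ (fun W'' => sel (insert x W''))) :
    BG u A S b a₀ sel := by
  sorry

/-- P1c(i) Lemma-5 leaf (PROVABLE, size S given H-glue: landed `stub_gluingLemma5` p75889 + `pockS ≥ 0`). -/
theorem blockGood_leaf_lemma5 (u : Sym2 (Fin n) → unitInterval) (A S : Finset (Fin n)) (b a₀ v : Fin n)
    (sel : Finset (Fin n) → Fin n) (hv : v ∈ S) (hbS : b ∉ S) (ha₀S : a₀ ∉ S)
    (hle : (prodBernoulli u).real (openConn a₀ b) ≤ (prodBernoulli u).real (openConn v b)) :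
    BG u A S b a₀ sel := by
  sorry

/-- P1c(ii) IH leaf (PROVABLE, size M: k13 `goodStepK13_designated_of_good` / k32 `goodStep_single`
pattern for a block observer + H-glue): if `a₀` is a minimiser of the GLUED two-point function, GOOD of
the glued quadruple (an IH instance) gives BG. -/
theorem blockGood_leaf_ih (u : Sym2 (Fin n) → unitInterval) (A S : Finset (Fin n)) (b a₀ s₀ : Fin n)
    (sel : Finset (Fin n) → Fin n) (hs₀ : s₀ ∈ S) (hSA : Disjoint S A) (hbA : b ∈ A) (ha₀A : a₀ ∈ A)
    (hsel : ∀ W, sel W ∈ A)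
    (hmin : ∀ a ∈ A, (prodBernoulli (glueW u S)).real (openConn a₀ b) ≤
      (prodBernoulli (glueW u S)).real (openConn a b))
    (hgood : Good (glueW u S) A s₀ b) :
    BG u A S b a₀ sel := by
  sorry

/-- The peeling CERTIFICATE (ideator 2): a finite tree of choices closing BG by P1b at internal nodes and
P1c at leaves.  `blockGood_of_cert` is 20 lines from P1b/P1c; the unconditional corollary "GLUE-GOOD for
every hereditarily certified bad block" strictly contains k24's one-bad class and KN Thms 4–5.  The
residue `¬ Cert` (RES) is the honest open part of this line. -/
inductive Cert : (Sym2 (Fin n) → unitInterval) → Finset (Fin n) → Finset (Fin n) → Fin n → Fin n → Prop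
  | lemma5 (u A S b a₀) (v : Fin n) (hv : v ∈ S) (hbS : b ∉ S) (ha₀S : a₀ ∉ S)
      (hle : (prodBernoulli u).real (openConn a₀ b) ≤ (prodBernoulli u).real (openConn v b)) :
      Cert u A S b a₀
  | ih (u A S b a₀) (s₀ : Fin n) (hs₀ : s₀ ∈ S) (hSA : Disjoint S A)
      (hmin : ∀ a ∈ A, (prodBernoulli (glueW u S)).real (openConn a₀ b) ≤
        (prodBernoulli (glueW u S)).real (openConn a b))
      (hgood : Good (glueW u S) A s₀ b) : Cert u A S b a₀
  | peel (u A S b a₀) (x : Fin n) (hx : x ∈ S) (hSA : Disjoint S A)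
      (hchildren : ∀ S' : Finset (Fin n), x ∉ S' →
        (prodBernoulli u).real {ω : BondConfig (Fin n) | ∀ y : Fin n, y ≠ x → (s(x, y) ∈ ω ↔ y ∈ S')} ≠ 0 →
        Cert (killSet u {x}) A (S.erase x ∪ S') b a₀) : Cert u A S b a₀

theorem blockGood_of_cert (u : Sym2 (Fin n) → unitInterval) (A S : Finset (Fin n)) (b a₀ : Fin n)
    (hbA : b ∈ A) (ha₀A : a₀ ∈ A) (h : Cert u A S b a₀) :
    ∀ sel : Finset (Fin n) → Fin n, (∀ W, sel W ∈ A) → BG u A S b a₀ sel := by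
  sorry

/-! ## LINE 3 (rank 3) — import Kozma–Nitzan Thm 2 WITH pockets (ideator 1): GOOD(3) in the KN regime.
Signatures H5a/H5b (set-source BHK 1.2/1.4), H1 `knLemma2_pair`, H2 `knThm2_patternI`, H3 `knThm2`,
H6 `goodStep_cardFour_knRegime` elaborate in `STUB_IDEAS_stub_goodStep_1_Sketch.lean` (same crux dir)
and are adopted verbatim; only H6 is restated here as the partial-result stub to register. -/

/-- PARTIAL-RESULT STUB `stub_goodStepCardFourKN` (register if the lead agrees; = ideator 1's H6):
the conclusion of `stub_goodStep` for `A.card = 4` under KN's Theorem-2 side condition at the worst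
relay, NO induction hypothesis, any observer. -/
theorem stub_goodStepCardFourKN :
    ∀ (n : ℕ) (w : Sym2 (Fin n) → unitInterval) (A : Finset (Fin n)) (o b a₁ : Fin n),
      b ∈ A → o ∉ A → A.card = 4 → a₁ ∈ A → a₁ ≠ b →
      (∀ a ∈ A, (prodBernoulli w).real (openConn a₁ b) ≤ (prodBernoulli w).real (openConn a b)) →
      (prodBernoulli w).real (openConn b a₁ ∩ ⋂ a ∈ (A.erase b).erase a₁, (openConn b a : Set _)ᶜ) ≤
        (prodBernoulli w).real ((⋂ a ∈ (A.erase b).erase a₁, (openConn b a : Set _)) ∩ (openConn b a₁)ᶜ) →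
      Good w A o b := by
  sorry

end

end Summit.CriticalPhenomena.PercolationContinuityZ3.Cruxes.AdditiveGluing.StubPlanGoodStep
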